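import Summits.Ventures.CertifiedManyBodySolver.Rows.SourcedTorusRowsBorderHook
import Literature.MathematicalPhysics.QuantumLattice.DWaveSourceNNNHoppingTwisted
import Literature.MathematicalPhysics.QuantumLattice.DWaveSourceNNNHoppingTwistedFlip
import HarnessLib

/-!
# PINNING-FIELD rows: the border hook in EVERY symmetrised orbit state — `U_w D_γ` (`χ_{B₁g} = 1`) and the gauge-twisted
# `D₄` family (all eight point-group operations)

Sequel of `Rows/SourcedTorusRowsBorderHook.lean` (§4 there: the hook in the orbit state at `S = {1}`). The cell's reduced
window certificates are read in orbit states `ω̄_ψ = orbitState T ψ` over a unitary family `T` commuting with the pair-sourced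
torus `A_L = dWaveSourceTorusTT' L tp U μ h` and CLOSED under right translations — `T = spaceGroupUnitary S`
(`S ∋ 1` closed under products, `χ_{B₁g} = 1` on `S`; `Literature/…/DWaveSourceNNNHoppingWindowCertificate[KKT]`) and the
TWISTED family `T = twistedSpaceGroupUnitary S` (ALL eight `γ`; `Literature/…/DWaveSourceNNNHoppingTwisted[WindowCertificateKKT]`,
`Rows/SourcedTorusRowsTwistedHook` p479690). This file supplies the ONE missing lemma so that such certificates may carry
a Ward–Bogoliubov border summand `Σ_ab Γm_ab • D_ab`:

* `re_orbitState_nonneg_of_forall_groundState_translationSum` (ABSTRACT TRANSFER): for a Hermitian `A`, a finite family `T`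
  with `T_g A = A T_g`, `T_gᴴ T_g = 1` and `T_g U_v = T_{σ_v g}` (closure under translations), and a torus operator `X`
  whose TRANSLATION SUM `Σ_v T_v X` has nonnegative real expectation in EVERY ground vector of `A`:
  `0 ≤ Re orbitState T ψ X` for every ground vector `ψ` (`ω̄_ψ(X) = ω̄_ψ(U_v X U_vᴴ)` by closure, so
  `ω̄_ψ(X) = L⁻² ω̄_ψ(Σ_v T_v X)`, an average of vector states of the ground vectors `T_gᴴψ`).
* `re_orbitState_borderForm_nonneg_of_closed`: the border summand of the hook satisfies the hypothesis
  (`expect (Σ_v T_v Γ_Ω B) φ = L²·torusAvgExpectAt L Ω B φ ≥ 0`, `re_torusAvg_borderForm_nonneg`), hence is an admissible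
  nonnegative residual in EVERY such orbit state; instances `…_spaceGroup` (`U_w D_γ`, `χ_{B₁g} = 1` on `S`) and
  `…_twisted` (`twistedSpaceGroupUnitary S`, all eight operations: the «symmetrise over all 8 ops» menus).

HONEST FRAMING: soundness glue; zero compute; nothing here is a number, an order parameter or a phase word. No definition,
no named fact, no `sorry`. Elaborated under the torus files' local `DecidableEq (FermionTorus 2 L)` instance; the hook
(`re_torusAvg_borderForm_nonneg`, library instances) is met once by `convert` (`Subsingleton.elim`). Cell `hubbard-cq`, seat `hubbard-cq-p1` (lead ACKS 52/55, 2026-08-27).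

References: O. Bratteli, D. W. Robinson II (1997), §6.2.4 and Prop. 5.3.19 [BratteliRobinsonII1997]; X. Han,
arXiv:2006.06002, §2 eq. (2), §3 [Han2020Bootstrap]; L. Pitaevskii, S. Stringari, J. Low Temp. Phys. 85 (1991) 377, §2
[PitaevskiiStringari1991].
-/

noncomputable section

namespace Summit.Ventures.CertifiedManyBodySolver

open Literature.MathematicalPhysics.QuantumLattice
open Matrix HubbardWave0 Literature.Probability.LatticeModels Finset
open scoped BigOperators ComplexOrder

/-- (Local to this file, as in every torus file handling `spaceGroupUnitary` / `fockD4` / the twisted family: torus sites are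
compared through the linear order; the hook file's library-instance theorem is met once, by `convert` (`Subsingleton.elim`).) -/
local instance (priority := high) instDecidableEqFermionTorusBorderHookOrbit {L : ℕ} :
    DecidableEq (FermionTorus 2 L) :=
  LinearOrder.toDecidableEq

variable {L : ℕ} [NeZero L]

/-! ## §1 Abstract transfer: closure under translations reduces any orbit state to translation sums -/

section Transfer

variable {G : Type*} [Fintype G]

/-- **Orbit states closed under translations see only translation sums**: if `T_g U_v = T_{σ_v g}` for every torus
vector `v`, then `L² · ω̄_ψ(X) = ω̄_ψ(Σ_v T_v X)` (`T_v X = U_v X U_vᴴ`, `orbitState_conj_of_closed`).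
[cite: Han2020Bootstrap, §2 eq. (2)] -/
theorem sq_mul_orbitState_eq_orbitState_translationSum
    (T : G → Matrix (Finset (Orb (FermionTorus 2 L))) (Finset (Orb (FermionTorus 2 L))) ℂ)
    (hclosed : ∀ v : TorusSite 2 L, ∃ σ : G ≃ G, ∀ g, T g * (fockTranslate v).val = T (σ g))
    (ψ : Fock (Orb (FermionTorus 2 L)))
    (X : Matrix (Finset (Orb (FermionTorus 2 L))) (Finset (Orb (FermionTorus 2 L))) ℂ) :
    ((L : ℂ) ^ 2) * orbitState T ψ X = orbitState T ψ (∑ v : TorusSite 2 L, relabel (Orb.translate v) X) := by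
  rw [map_sum]
  have hv : ∀ v : TorusSite 2 L, orbitState T ψ (relabel (Orb.translate v) X) = orbitState T ψ X := by
    intro v
    rw [relabel_eq_fockRelabel_conj]
    exact orbitState_conj_of_closed T ψ (hclosed v) X
  simp_rw [hv]
  rw [Finset.sum_const, Finset.card_univ, show Fintype.card (TorusSite 2 L) = L ^ 2 by
    rw [Fintype.card_fun, ZMod.card, Fintype.card_fin], nsmul_eq_mul, Nat.cast_pow]

omit [NeZero L] in
/-- A matrix `U` commuting with the Hermitian `A`, with `Uᴴ` injective (e.g. `U` unitary), maps ground vectors to ground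
vectors under `Uᴴ`.
[cite: BratteliRobinsonII1997, §6.2.4] -/
theorem isGroundStateVector_conjTranspose_mulVec_of_commute
    {A U : Matrix (Finset (Orb (FermionTorus 2 L))) (Finset (Orb (FermionTorus 2 L))) ℂ} (hA : A.IsHermitian)
    (hUA : U * A = A * U) (hU0 : ∀ φ : Fock (Orb (FermionTorus 2 L)), Uᴴ *ᵥ φ = 0 → φ = 0)
    {ψ : Fock (Orb (FermionTorus 2 L))} (hψ : A.IsGroundStateVector ψ) :
    A.IsGroundStateVector (Uᴴ *ᵥ ψ) := by
  have hc : Uᴴ * A = A * Uᴴ := conjTranspose_commute_of_commute hA hUA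
  refine ⟨fun h0 => hψ.1 (hU0 ψ h0), ?_⟩
  rw [mulVec_mulVec, ← hc, ← mulVec_mulVec, hψ.2, mulVec_smul]

/-- **ABSTRACT TRANSFER.** `A` Hermitian; `T` a finite family with `T_g A = A T_g`, every `T_gᴴ` injective (unitary), closed
under right translations; `X` a torus operator whose translation sum has nonnegative real expectation in EVERY ground vector of `A`.
Then `0 ≤ Re orbitState T ψ X` for every ground vector `ψ` (`L²·ω̄_ψ(X) = |G|⁻¹ Σ_g ⟨T_gᴴψ, (Σ_v T_v X) T_gᴴψ⟩`).
[cite: BratteliRobinsonII1997, §6.2.4] [cite: Han2020Bootstrap, §2 eq. (2)] -/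
theorem re_orbitState_nonneg_of_forall_groundState_translationSum [Nonempty G]
    {A : Matrix (Finset (Orb (FermionTorus 2 L))) (Finset (Orb (FermionTorus 2 L))) ℂ} (hA : A.IsHermitian)
    (T : G → Matrix (Finset (Orb (FermionTorus 2 L))) (Finset (Orb (FermionTorus 2 L))) ℂ)
    (hTA : ∀ g, T g * A = A * T g) (hT0 : ∀ g, ∀ φ : Fock (Orb (FermionTorus 2 L)), (T g)ᴴ *ᵥ φ = 0 → φ = 0)
    (hclosed : ∀ v : TorusSite 2 L, ∃ σ : G ≃ G, ∀ g, T g * (fockTranslate v).val = T (σ g))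
    {X : Matrix (Finset (Orb (FermionTorus 2 L))) (Finset (Orb (FermionTorus 2 L))) ℂ}
    (hX : ∀ φ : Fock (Orb (FermionTorus 2 L)), A.IsGroundStateVector φ →
      0 ≤ (star φ ⬝ᵥ (∑ v : TorusSite 2 L, relabel (Orb.translate v) X) *ᵥ φ).re)
    {ψ : Fock (Orb (FermionTorus 2 L))} (hψ : A.IsGroundStateVector ψ) :
    0 ≤ (orbitState T ψ X).re := by
  have hL : (0 : ℝ) < (L : ℝ) ^ 2 := by
    have : (0 : ℝ) < (L : ℝ) := by exact_mod_cast Nat.pos_of_ne_zero (NeZero.ne L)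
    positivity
  have hsum : 0 ≤ (orbitState T ψ (∑ v : TorusSite 2 L, relabel (Orb.translate v) X)).re := by
    rw [orbitState_apply, ← Complex.ofReal_natCast, ← Complex.ofReal_inv, Complex.re_ofReal_mul, Complex.re_sum]
    refine mul_nonneg (inv_nonneg.2 (Nat.cast_nonneg _)) (Finset.sum_nonneg fun g _ => ?_)
    rw [Literature.MathematicalPhysics.QuantumManyBody.StateRelaxation.vectorState_apply]
    exact hX _ (isGroundStateVector_conjTranspose_mulVec_of_commute hA (hTA g) (hT0 g) hψ)
  rw [← sq_mul_orbitState_eq_orbitState_translationSum T hclosed ψ X, ← Complex.ofReal_natCast,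
    ← Complex.ofReal_pow, Complex.re_ofReal_mul] at hsum
  exact (mul_nonneg_iff_of_pos_left hL).1 hsum

end Transfer

/-! ## §2 The border summand in every symmetrised orbit state -/

section Border

variable (tp U μ h : ℝ) {Λ Λ' Ω Z : Finset (Site 2)}

/-- **The border summand is admissible in every translation-closed symmetrised orbit state.** Under the hypotheses of
`posSemidef_borderBlock_torusAvg` (words `Y : β → 𝔄_Λ` with even adjoints, `Γm ⪰ 0`), for every finite family `T`
commuting with `A_L = dWaveSourceTorusTT' L tp U μ h`, with injective adjoints (unitary) and closed under right translations, and every ground vector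
`ψ`: `0 ≤ Re orbitState T ψ (Γ_Ω (Σ_a Σ_b Γm a b • D a b))`, `D a b = commDensity Ω Z (Y a)ᴴ (H^{src,tt'}_{Λ'}Ỹ_b − Ỹ_bH^{src,tt'}_{Λ'})`.
[cite: PitaevskiiStringari1991, §2] [cite: BratteliRobinsonII1997, Prop. 5.3.19] -/
theorem re_orbitState_borderForm_nonneg_of_closed {G : Type*} [Fintype G] [Nonempty G]
    (T : G → Matrix (Finset (Orb (FermionTorus 2 L))) (Finset (Orb (FermionTorus 2 L))) ℂ)
    (hTA : ∀ g, T g * dWaveSourceTorusTT' L tp U μ h = dWaveSourceTorusTT' L tp U μ h * T g)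
    (hT0 : ∀ g, ∀ φ : Fock (Orb (FermionTorus 2 L)), (T g)ᴴ *ᵥ φ = 0 → φ = 0)
    (hclosed : ∀ v : TorusSite 2 L, ∃ σ : G ≃ G, ∀ g, T g * (fockTranslate v).val = T (σ g))
    (hΛ : Λ ⊆ Λ') (h8 : thicken Λ 1 ⊆ Λ') (hΛ'Ω : Λ' ⊆ Ω)
    (hInj : Set.InjOn (Torus.proj (d := 2) L) ↑(thicken Λ' 1))
    (hΩ : Set.InjOn (Torus.proj (d := 2) L) ↑Ω) (hZinj : Set.InjOn (Torus.proj (d := 2) L) ↑Z)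
    (hZ : ∀ z ∈ Z, shiftSet z Λ ⊆ Ω) (hcomplete : ∀ a ∈ Λ, ∀ c ∈ Λ', c - a ∈ Z)
    {β : Type*} [Fintype β] [DecidableEq β] (Y : β → FermionOp Λ)
    (hY : ∀ b, (Y b)ᴴ ∈ carEvenSubalgebra (Finset.univ : Finset (Orb (PolySite Λ))))
    {Γm : Matrix β β ℂ} (hΓm : Γm.PosSemidef)
    {ψ : Fock (Orb (FermionTorus 2 L))} (hψ : (dWaveSourceTorusTT' L tp U μ h).IsGroundStateVector ψ) :
    0 ≤ (orbitState T ψ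
      (fermionEmbed (PolySite.toTorusEmb L hΩ) (∑ a, ∑ b, Γm a b •
        commDensity Ω Z hΛ'Ω (Y a)ᴴ
          (pairSourceWindowHamiltonianTT' dWaveFormFactor Λ' tp U μ h * fermionEmbed (PolySite.incl hΛ) (Y b) -
            fermionEmbed (PolySite.incl hΛ) (Y b) * pairSourceWindowHamiltonianTT' dWaveFormFactor Λ' tp U μ h)))).re := by
  refine re_orbitState_nonneg_of_forall_groundState_translationSum (dWaveSourceTorusTT'_isHermitian L tp U μ h) T hTA
    hT0 hclosed (fun φ hφ => ?_) hψ
  -- the translation sum of `Γ_Ω B` has expectation `L² · torusAvgExpectAt L Ω B φ ≥ 0`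
  have hexp := expect_sum_relabel_translate_fermionEmbed' L hΩ (∑ a, ∑ b, Γm a b •
        commDensity Ω Z hΛ'Ω (Y a)ᴴ
          (pairSourceWindowHamiltonianTT' dWaveFormFactor Λ' tp U μ h * fermionEmbed (PolySite.incl hΛ) (Y b) -
            fermionEmbed (PolySite.incl hΛ) (Y b) * pairSourceWindowHamiltonianTT' dWaveFormFactor Λ' tp U μ h)) φ
  rw [Literature.MathematicalPhysics.QuantumLattice.expect] at hexp
  rw [hexp, ← Complex.ofReal_natCast, ← Complex.ofReal_pow, Complex.re_ofReal_mul]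
  exact mul_nonneg (by positivity)
    (re_torusAvg_borderForm_nonneg tp U μ h hΛ h8 hΛ'Ω hInj hΩ hZinj hZ hcomplete Y hY hΓm (by convert hφ using 2))

/-- **Instance: the affine `D₄` orbit states of the untwisted certificates** (`T = spaceGroupUnitary S`, `S ∋ 1` closed
under products, `χ_{B₁g} = 1` on `S`). [cite: Han2020Bootstrap, §3] -/
theorem re_orbitState_borderForm_nonneg_spaceGroup {S : Finset (DihedralGroup 4)} (h1 : (1 : DihedralGroup 4) ∈ S)
    (hmul : ∀ a ∈ S, ∀ b ∈ S, a * b ∈ S) (hS : ∀ γ ∈ S, b1gChar γ = 1)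
    (hΛ : Λ ⊆ Λ') (h8 : thicken Λ 1 ⊆ Λ') (hΛ'Ω : Λ' ⊆ Ω)
    (hInj : Set.InjOn (Torus.proj (d := 2) L) ↑(thicken Λ' 1))
    (hΩ : Set.InjOn (Torus.proj (d := 2) L) ↑Ω) (hZinj : Set.InjOn (Torus.proj (d := 2) L) ↑Z)
    (hZ : ∀ z ∈ Z, shiftSet z Λ ⊆ Ω) (hcomplete : ∀ a ∈ Λ, ∀ c ∈ Λ', c - a ∈ Z)
    {β : Type*} [Fintype β] [DecidableEq β] (Y : β → FermionOp Λ)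
    (hY : ∀ b, (Y b)ᴴ ∈ carEvenSubalgebra (Finset.univ : Finset (Orb (PolySite Λ))))
    {Γm : Matrix β β ℂ} (hΓm : Γm.PosSemidef)
    {ψ : Fock (Orb (FermionTorus 2 L))} (hψ : (dWaveSourceTorusTT' L tp U μ h).IsGroundStateVector ψ) :
    0 ≤ (orbitState (spaceGroupUnitary S) ψ
      (fermionEmbed (PolySite.toTorusEmb L hΩ) (∑ a, ∑ b, Γm a b •
        commDensity Ω Z hΛ'Ω (Y a)ᴴ
          (pairSourceWindowHamiltonianTT' dWaveFormFactor Λ' tp U μ h * fermionEmbed (PolySite.incl hΛ) (Y b) -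
            fermionEmbed (PolySite.incl hΛ) (Y b) * pairSourceWindowHamiltonianTT' dWaveFormFactor Λ' tp U μ h)))).re := by
  haveI : Nonempty ↥S := ⟨⟨1, h1⟩⟩
  have hT0 : ∀ g : TorusSite 2 L × ↥S, ∀ φ : Fock (Orb (FermionTorus 2 L)),
      (spaceGroupUnitary S g)ᴴ *ᵥ φ = 0 → φ = 0 := by
    intro g φ h0
    -- `U Uᴴ = 1` (unitarity, stated in the torus files' vocabulary), applied to `φ`; no `1` is retyped here
    have hu := mul_eq_one_comm.1 (d4Affine_conjTranspose_mul_self (L := L) (g.2 : DihedralGroup 4) g.1)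
    have key := congrArg (fun M => M *ᵥ φ) hu
    simp only [one_mulVec] at key
    rw [← mulVec_mulVec] at key
    -- `key : U *ᵥ (Uᴴ *ᵥ φ) = φ` with `U = spaceGroupUnitary S g` definitionally
    have key' : spaceGroupUnitary S g *ᵥ ((spaceGroupUnitary S g)ᴴ *ᵥ φ) = φ := key
    rw [h0, mulVec_zero] at key'
    exact key'.symm
  exact re_orbitState_borderForm_nonneg_of_closed tp U μ h (spaceGroupUnitary S)
    (fun g => spaceGroupUnitary_mul_dWaveSourceTorusTT' hS tp U μ h g) hT0
    (fun v => spaceGroupUnitary_closed_translate h1 hmul v)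
    hΛ h8 hΛ'Ω hInj hΩ hZinj hZ hcomplete Y hY hΓm hψ

/-- **Instance: the gauge-TWISTED `D₄` orbit states** (`T = twistedSpaceGroupUnitary S`, `S ∋ 1` closed under products,
ALL eight point-group operations — the «symmetrise over all 8 ops» menus read through p479690's twisted hook).
[cite: Han2020Bootstrap, §3] -/
theorem re_orbitState_borderForm_nonneg_twisted {S : Finset (DihedralGroup 4)} (h1 : (1 : DihedralGroup 4) ∈ S)
    (hmul : ∀ a ∈ S, ∀ b ∈ S, a * b ∈ S)
    (hΛ : Λ ⊆ Λ') (h8 : thicken Λ 1 ⊆ Λ') (hΛ'Ω : Λ' ⊆ Ω)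
    (hInj : Set.InjOn (Torus.proj (d := 2) L) ↑(thicken Λ' 1))
    (hΩ : Set.InjOn (Torus.proj (d := 2) L) ↑Ω) (hZinj : Set.InjOn (Torus.proj (d := 2) L) ↑Z)
    (hZ : ∀ z ∈ Z, shiftSet z Λ ⊆ Ω) (hcomplete : ∀ a ∈ Λ, ∀ c ∈ Λ', c - a ∈ Z)
    {β : Type*} [Fintype β] [DecidableEq β] (Y : β → FermionOp Λ)
    (hY : ∀ b, (Y b)ᴴ ∈ carEvenSubalgebra (Finset.univ : Finset (Orb (PolySite Λ))))
    {Γm : Matrix β β ℂ} (hΓm : Γm.PosSemidef)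
    {ψ : Fock (Orb (FermionTorus 2 L))} (hψ : (dWaveSourceTorusTT' L tp U μ h).IsGroundStateVector ψ) :
    0 ≤ (orbitState (twistedSpaceGroupUnitary S) ψ
      (fermionEmbed (PolySite.toTorusEmb L hΩ) (∑ a, ∑ b, Γm a b •
        commDensity Ω Z hΛ'Ω (Y a)ᴴ
          (pairSourceWindowHamiltonianTT' dWaveFormFactor Λ' tp U μ h * fermionEmbed (PolySite.incl hΛ) (Y b) -
            fermionEmbed (PolySite.incl hΛ) (Y b) * pairSourceWindowHamiltonianTT' dWaveFormFactor Λ' tp U μ h)))).re := by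
  haveI : Nonempty ↥S := ⟨⟨1, h1⟩⟩
  have hT0 : ∀ g : (TorusSite 2 L × ↥S) × Fin 2, ∀ φ : Fock (Orb (FermionTorus 2 L)),
      (twistedSpaceGroupUnitary S g)ᴴ *ᵥ φ = 0 → φ = 0 := by
    intro g φ h0
    have hu := mul_eq_one_comm.1 (twistedSpaceGroupUnitary_conjTranspose_mul_self (L := L) S g)
    have key := congrArg (fun M => M *ᵥ φ) hu
    simp only [one_mulVec] at key
    rw [← mulVec_mulVec, h0, mulVec_zero] at key
    exact key.symm
  exact re_orbitState_borderForm_nonneg_of_closed tp U μ h (twistedSpaceGroupUnitary S)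
    (fun g => twistedSpaceGroupUnitary_mul_dWaveSourceTorusTT' S tp U μ h g) hT0
    (fun v => twistedSpaceGroupUnitary_closed_translate h1 hmul v)
    hΛ h8 hΛ'Ω hInj hΩ hZinj hZ hcomplete Y hY hΓm hψ

end Border

/-! ## §3 The border summand in the SIXTEEN-element flip-twisted `D₄ × ℤ₂^flip` orbit states

Appended 2026-08-27 (seat `hubbard-cq-p1` g3; lead ACKS 69): per obsth-1's FINDING (p481142) the cell's sourced `gbT`
certificates are symmetrised under the flip-twisted family `twistedFlipSpaceGroupUnitary S`
(`U_v D_γ F^f 𝒢_{j(γ)+f+2m}`, `Literature/…/TwistedFlipSpaceGroupUnitary`), which commutes with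
`dWaveSourceTorusTT' L tp U μ h` for EVERY `S ⊆ D₄` (`twistedFlipSpaceGroupUnitary_mul_dWaveSourceTorusTT'`,
`Literature/…/DWaveSourceNNNHoppingTwistedFlip`), is unitary and is closed under right translations when `1 ∈ S` and `S` is
closed under products. Hence the abstract transfer of §1 applies verbatim: the third instance below. -/

section BorderFlip

variable (tp U μ h : ℝ) {Λ Λ' Ω Z : Finset (Site 2)}

/-- **Instance: the FLIP-TWISTED `D₄ × ℤ₂^flip` orbit states** (`T = twistedFlipSpaceGroupUnitary S`, `S ∋ 1` closed under
products; all eight point-group operations AND the spin exchange — the sixteen-element identification under which the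
cell's sourced `gbT` certificates are built, p481142). The Ward–Bogoliubov border summand
`Γ_Ω (Σ_a Σ_b Γm a b • D a b)` is an admissible nonnegative residual in every such orbit state of every ground vector.
[cite: Han2020Bootstrap, §3] [cite: BratteliRobinsonII1997, §6.2.4] -/
theorem re_orbitState_borderForm_nonneg_twistedFlip {S : Finset (DihedralGroup 4)} (h1 : (1 : DihedralGroup 4) ∈ S)
    (hmul : ∀ a ∈ S, ∀ b ∈ S, a * b ∈ S)
    (hΛ : Λ ⊆ Λ') (h8 : thicken Λ 1 ⊆ Λ') (hΛ'Ω : Λ' ⊆ Ω)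
    (hInj : Set.InjOn (Torus.proj (d := 2) L) ↑(thicken Λ' 1))
    (hΩ : Set.InjOn (Torus.proj (d := 2) L) ↑Ω) (hZinj : Set.InjOn (Torus.proj (d := 2) L) ↑Z)
    (hZ : ∀ z ∈ Z, shiftSet z Λ ⊆ Ω) (hcomplete : ∀ a ∈ Λ, ∀ c ∈ Λ', c - a ∈ Z)
    {β : Type*} [Fintype β] [DecidableEq β] (Y : β → FermionOp Λ)
    (hY : ∀ b, (Y b)ᴴ ∈ carEvenSubalgebra (Finset.univ : Finset (Orb (PolySite Λ))))
    {Γm : Matrix β β ℂ} (hΓm : Γm.PosSemidef)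
    {ψ : Fock (Orb (FermionTorus 2 L))} (hψ : (dWaveSourceTorusTT' L tp U μ h).IsGroundStateVector ψ) :
    0 ≤ (orbitState (twistedFlipSpaceGroupUnitary S) ψ
      (fermionEmbed (PolySite.toTorusEmb L hΩ) (∑ a, ∑ b, Γm a b •
        commDensity Ω Z hΛ'Ω (Y a)ᴴ
          (pairSourceWindowHamiltonianTT' dWaveFormFactor Λ' tp U μ h * fermionEmbed (PolySite.incl hΛ) (Y b) -
            fermionEmbed (PolySite.incl hΛ) (Y b) * pairSourceWindowHamiltonianTT' dWaveFormFactor Λ' tp U μ h)))).re := by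
  haveI : Nonempty ↥S := ⟨⟨1, h1⟩⟩
  have hT0 : ∀ g : ((TorusSite 2 L × ↥S) × Fin 2) × Fin 2, ∀ φ : Fock (Orb (FermionTorus 2 L)),
      (twistedFlipSpaceGroupUnitary S g)ᴴ *ᵥ φ = 0 → φ = 0 := by
    intro g φ h0
    have hu := mul_eq_one_comm.1 (twistedFlipSpaceGroupUnitary_conjTranspose_mul_self (L := L) S g)
    have key := congrArg (fun M => M *ᵥ φ) hu
    simp only [one_mulVec] at key
    rw [← mulVec_mulVec, h0, mulVec_zero] at key
    exact key.symm
  exact re_orbitState_borderForm_nonneg_of_closed tp U μ h (twistedFlipSpaceGroupUnitary S)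
    (fun g => twistedFlipSpaceGroupUnitary_mul_dWaveSourceTorusTT' S tp U μ h g) hT0
    (fun v => twistedFlipSpaceGroupUnitary_closed_translate h1 hmul v)
    hΛ h8 hΛ'Ω hInj hΩ hZinj hZ hcomplete Y hY hΓm hψ

end BorderFlip

end Summit.Ventures.CertifiedManyBodySolver

end
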